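import Literature.Geometry.Lorentzian.GreenIdentityCompactSupport
import Literature.Geometry.Lorentzian.VolumeProofs
import HarnessLib

/-!
# The `L^q` limit of a Dirichlet-energy minimising sequence is distributionally harmonic
(Carron 2007, Prop. 2.5 / Remark 2.6: "`Δ h = d*d(u - v) = d*η = 0`")

Fifth layer (analysis, part C) of the proof programme of
`Literature.Geometry.Riemannian.Carron1998_ends_le_rank_l2HarmonicOneForms`
(`L2HarmonicOneFormsSobolev.lean`). In G. Carron, *L² harmonic forms on non-compact Riemannian
manifolds*, arXiv:0704.3194 (2007), the function `h = u - v` attached to an end is harmonic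
because `dh` is the harmonic (coclosed) representative of `[du]` (Prop. 2.5), equivalently
because it minimises the Dirichlet energy (Remark 2.6). In the variational form followed by this
tree (`DirichletEnergyMinimisers.lean`): if `vₙ ∈ C_c^∞(N)` have asymptotically vanishing first
variation, `∫ h⁻¹(d(χ - vₙ), dζ) dV_h → 0` for all `ζ ∈ C_c^∞`, and `vₙ → w` in `L^q(dV_h)` for
some `q ≥ 1`, then `u = χ - w` is a distributional solution of `Δ_h u = 0`. For a Riemannian
manifold `(N, h)` modelled on `ℝ^m` (boundaryless model with corners on `EuclideanSpace ℝ (Fin m)`,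
Hausdorff, σ-compact; `h` a smooth Mathlib metric), this file PROVES

* `tendsto_integral_sub_mul_of_tendsto_eLpNorm` — `L^q`-convergence tested against a bounded
  function vanishing off a set of finite measure: `∫ (vₙ - w) F dν → 0` (comparison
  `L¹(S) ≤ ν(S)^{1-1/q} L^q(S)`, Mathlib's `eLpNorm_le_eLpNorm_mul_rpow_measure_univ`);
* `integral_sub_mul_dalembertian_eq_zero` — **distributional harmonicity of the limit**:
  `∫ (χ - w) Δ_h ζ dV_h = 0` for every `ζ ∈ C_c^∞(N)` (Green's first identity for compactly
  supported `ζ`, `integral_mul_dalembertian_eq_neg_integral_innerDual_of_hasCompactSupport_right`,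
  gives `∫ (χ - vₙ) Δ_h ζ = -∫ h⁻¹(d(χ - vₙ), dζ) → 0`, while `∫ (χ - vₙ) Δ_h ζ → ∫ (χ - w) Δ_h ζ`).

Everything is proved; no definitions, no named facts (D-0026).

## References

* G. Carron, *L² harmonic forms on non-compact Riemannian manifolds*, arXiv:0704.3194 (2007),
  Prop. 2.5 and Remark 2.6. [`Carron2007`]
* J. M. Lee, *Introduction to Riemannian Manifolds*, 2nd ed. (2018), Problem 2-23 (a) (Green's
  identity). [`Lee2018`]
-/

noncomputable section

open Bundle Set Function Filter Topology MeasureTheory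
open scoped Manifold ContDiff ENNReal NNReal

namespace Literature.Geometry.Riemannian

open Literature.Geometry.Lorentzian
open Literature.Geometry.Lorentzian.PseudoRiemannianMetric

/-! ### `L^q` convergence tested against bounded functions of finite-measure support -/

section Lq

variable {X : Type*} [MeasurableSpace X] {ν : Measure X}

/-- **`L^q` convergence against a bounded test function vanishing off a set of finite measure**:
if `vₙ, w ∈ L^q(ν)` (`q ≥ 1`) with `‖vₙ - w‖_{L^q} → 0`, `F` is a.e.-strongly measurable,
`|F| ≤ C`, and `F = 0` off a measurable set `S` with `ν S < ∞`, then the products `(vₙ - w) F`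
are integrable and `∫ (vₙ - w) F dν → 0`:
`|∫ (vₙ - w) F| ≤ C ‖vₙ - w‖_{L¹(S)} ≤ C ν(S)^{1 - 1/q} ‖vₙ - w‖_{L^q}`. [folklore] -/
theorem tendsto_integral_sub_mul_of_tendsto_eLpNorm {v : ℕ → X → ℝ} {w F : X → ℝ} {q : ℝ≥0∞}
    (hq1 : 1 ≤ q) (hvq : ∀ n, MemLp (v n) q ν) (hw : MemLp w q ν)
    (hlim : Tendsto (fun n ↦ eLpNorm (v n - w) q ν) atTop (𝓝 0))
    {S : Set X} (hS : MeasurableSet S) (hSfin : ν S < ⊤) {C : ℝ} (hC : 0 ≤ C)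
    (hFC : ∀ x, |F x| ≤ C) (hFS : ∀ x ∉ S, F x = 0) (hFm : AEStronglyMeasurable F ν) :
    (∀ n, Integrable (fun x ↦ (v n x - w x) * F x) ν) ∧
    Tendsto (fun n ↦ ∫ x, (v n x - w x) * F x ∂ν) atTop (𝓝 0) := by
  haveI : Fact (ν S < ⊤) := ⟨hSfin⟩
  set e : ℝ := 1 / (1 : ℝ≥0∞).toReal - 1 / q.toReal with he
  have he0 : 0 ≤ e := by
    rw [he]; simp only [ENNReal.toReal_one, div_one]
    have : 1 / q.toReal ≤ 1 := by
      rcases eq_or_ne q ⊤ with hq | hq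
      · simp [hq]
      · have h0 : q ≠ 0 := by intro h0; rw [h0] at hq1; exact absurd hq1 (by simp)
        rw [div_le_one (ENNReal.toReal_pos h0 hq)]
        simpa using ENNReal.toReal_mono hq hq1
    linarith
  -- for each `n`: integrability on `S`, integrability of the product, and the bound
  have key : ∀ n, Integrable (fun x ↦ (v n x - w x) * F x) ν ∧
      |∫ x, (v n x - w x) * F x ∂ν| ≤ C * (eLpNorm (v n - w) q ν * ν S ^ e).toReal := by
    intro n
    have hf : MemLp (v n - w) q ν := (hvq n).sub hw
    have hfm : AEStronglyMeasurable (v n - w) ν := hf.1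
    -- `vₙ - w ∈ L¹(S)`
    have hf1 : MemLp (v n - w) 1 (ν.restrict S) := (hf.restrict S).mono_exponent hq1
    have hIS : IntegrableOn (v n - w) S ν := memLp_one_iff_integrable.1 hf1
    -- the product is dominated by `S.indicator (C |vₙ - w|)`
    have hdom : Integrable (S.indicator fun x ↦ C * |(v n - w) x|) ν :=
      IntegrableOn.integrable_indicator (hIS.abs.const_mul C) hS
    have hbd : ∀ x, ‖(v n x - w x) * F x‖ ≤ S.indicator (fun x ↦ C * |(v n - w) x|) x := by
      intro x
      rw [Real.norm_eq_abs, abs_mul]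
      by_cases hx : x ∈ S
      · rw [indicator_of_mem hx, mul_comm]
        exact mul_le_mul_of_nonneg_right (hFC x) (abs_nonneg _)
      · rw [indicator_of_notMem hx, hFS x hx, abs_zero, mul_zero]
    have hprodm : AEStronglyMeasurable (fun x ↦ (v n x - w x) * F x) ν := by
      have : AEStronglyMeasurable (fun x ↦ (v n - w) x * F x) ν := hfm.mul hFm
      exact this
    have hI : Integrable (fun x ↦ (v n x - w x) * F x) ν :=
      hdom.mono' hprodm (Eventually.of_forall hbd)
    refine ⟨hI, ?_⟩
    -- the bound
    have hfin : eLpNorm (v n - w) q ν * ν S ^ e ≠ ⊤ :=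
      ENNReal.mul_ne_top hf.eLpNorm_ne_top (ENNReal.rpow_ne_top_of_nonneg he0 hSfin.ne)
    calc |∫ x, (v n x - w x) * F x ∂ν| ≤ ∫ x, ‖(v n x - w x) * F x‖ ∂ν := by
          rw [← Real.norm_eq_abs]; exact norm_integral_le_integral_norm _
      _ ≤ ∫ x, S.indicator (fun x ↦ C * |(v n - w) x|) x ∂ν :=
          integral_mono hI.norm hdom hbd
      _ = C * ∫ x in S, |(v n - w) x| ∂ν := by
          rw [integral_indicator hS, integral_const_mul]
      _ = C * (eLpNorm (v n - w) 1 (ν.restrict S)).toReal := by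
          congr 1
          rw [eLpNorm_one_eq_lintegral_enorm, ← integral_norm_eq_lintegral_enorm hfm.restrict]
          rfl
      _ ≤ C * (eLpNorm (v n - w) q ν * ν S ^ e).toReal := by
          refine mul_le_mul_of_nonneg_left (ENNReal.toReal_mono hfin ?_) hC
          have h3 := eLpNorm_le_eLpNorm_mul_rpow_measure_univ hq1 (hfm.restrict (s := S))
          rw [Measure.restrict_apply_univ] at h3
          exact h3.trans (mul_le_mul' (eLpNorm_restrict_le _ _ _ _) le_rfl)
  refine ⟨fun n ↦ (key n).1, ?_⟩
  -- the right-hand sides tend to zero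
  have h1 : Tendsto (fun n ↦ eLpNorm (v n - w) q ν * ν S ^ e) atTop (𝓝 (0 * ν S ^ e)) :=
    ENNReal.Tendsto.mul_const hlim (Or.inr (ENNReal.rpow_ne_top_of_nonneg he0 hSfin.ne))
  rw [zero_mul] at h1
  have h2 : Tendsto (fun n ↦ C * (eLpNorm (v n - w) q ν * ν S ^ e).toReal) atTop (𝓝 (C * 0)) :=
    ((ENNReal.tendsto_toReal ENNReal.zero_ne_top).comp h1).const_mul C |>.congr fun n ↦ rfl
  rw [mul_zero] at h2
  exact squeeze_zero_norm (fun n ↦ by rw [Real.norm_eq_abs]; exact (key n).2) h2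

end Lq

/-! ### Distributional harmonicity of the limit -/

section Harmonic

variable {m : ℕ} {H : Type*} [TopologicalSpace H]
  {I : ModelWithCorners ℝ (EuclideanSpace ℝ (Fin m)) H} [I.Boundaryless]
  {N : Type*} [TopologicalSpace N] [ChartedSpace H N] [IsManifold I ∞ N]
  [T3Space N] [SecondCountableTopology N] [MeasurableSpace N] [BorelSpace N]
  (h : ContMDiffRiemannianMetric I ∞ (EuclideanSpace ℝ (Fin m)) (TangentSpace I : N → Type _))
  [(ofRiemannian h).HasLeviCivita]

/-- **The `L^q` limit of an asymptotically critical sequence is distributionally harmonic**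
(Carron 2007, Prop. 2.5: "`Δ h = d*d(u - v) = d*η = 0`"; Remark 2.6, the minimiser of
`u ↦ ∫ |du|²` is harmonic). Let `χ ∈ C^∞(N)`, `vₙ ∈ C_c^∞(N)` with
`∫ h⁻¹(d(χ - vₙ), dζ) dV_h → 0` for every `ζ ∈ C_c^∞(N)`, and `vₙ → w` in `L^q(dV_h)`, `q ≥ 1`
(`vₙ, w ∈ L^q`). Then `∫_N (χ - w) Δ_h ζ dV_h = 0` for every `ζ ∈ C_c^∞(N)`: by Green's first
identity `∫ (χ - vₙ) Δ_h ζ = -∫ h⁻¹(d(χ - vₙ), dζ) → 0`, and `∫ (χ - vₙ) Δ_h ζ → ∫ (χ - w) Δ_h ζ`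
since `Δ_h ζ` is bounded with compact support. [cite: Carron2007, Prop. 2.5 and Remark 2.6] -/
theorem integral_sub_mul_dalembertian_eq_zero {χ : N → ℝ} (hχ : ContMDiff I 𝓘(ℝ, ℝ) ∞ χ)
    {v : ℕ → N → ℝ} (hv : ∀ n, ContMDiff I 𝓘(ℝ, ℝ) ∞ (v n)) (hvc : ∀ n, HasCompactSupport (v n))
    {q : ℝ≥0∞} (hq1 : 1 ≤ q) {w : N → ℝ} (hw : MemLp w q (riemannianMeasure h))
    (hlim : Tendsto (fun n ↦ eLpNorm (v n - w) q (riemannianMeasure h)) atTop (𝓝 0))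
    (hvar : ∀ ζ : N → ℝ, ContMDiff I 𝓘(ℝ, ℝ) ∞ ζ → HasCompactSupport ζ →
      Tendsto (fun n ↦ ∫ x, (ofRiemannian h).innerDual x (mvfderiv I (χ - v n) x).toLinearMap
        (mvfderiv I ζ x).toLinearMap ∂riemannianMeasure h) atTop (𝓝 0))
    {ζ : N → ℝ} (hζ : ContMDiff I 𝓘(ℝ, ℝ) ∞ ζ) (hζc : HasCompactSupport ζ) :
    ∫ x, (χ x - w x) * (ofRiemannian h).dalembertian ζ x ∂riemannianMeasure h = 0 := by
  haveI : LocallyCompactSpace N := Manifold.locallyCompact_of_finiteDimensional I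
  set ν : Measure N := riemannianMeasure h with hν
  haveI : IsFiniteMeasureOnCompacts ν :=
    ⟨fun K hK ↦ riemannianVolume_lt_top_of_isCompact_holds h le_rfl hK⟩
  set F : N → ℝ := (ofRiemannian h).dalembertian ζ with hF
  have hζ2 : CMDiff 2 ζ := by exact_mod_cast contMDiff_infty.1 hζ 2
  have hFc : Continuous F := continuous_dalembertian _ hζ2
  have hFsupp : ∀ x ∉ tsupport ζ, F x = 0 := fun x hx ↦
    dalembertian_eq_zero_of_notMem_tsupport _ hx
  have hFcs : HasCompactSupport F :=
    HasCompactSupport.of_support_subset_isCompact hζc.isCompact fun x hx ↦ by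
      by_contra hx'; exact hx (hFsupp x hx')
  obtain ⟨C, hC⟩ := hFcs.exists_bound_of_continuous hFc
  have hFC : ∀ x, |F x| ≤ max C 0 := fun x ↦
    (Real.norm_eq_abs (F x) ▸ hC x).trans (le_max_left _ _)
  -- Step 1: Green's identity, `∫ (χ - vₙ) Δζ = -∫ h⁻¹(d(χ - vₙ), dζ)`
  have hgreen : ∀ n, ∫ x, (χ x - v n x) * F x ∂ν =
      -∫ x, (ofRiemannian h).innerDual x (mvfderiv I (χ - v n) x).toLinearMap
        (mvfderiv I ζ x).toLinearMap ∂ν := by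
    intro n
    have hu1 : CMDiff 1 (χ - v n) := by exact_mod_cast contMDiff_infty.1 (hχ.sub (hv n)) 1
    have hG := integral_mul_dalembertian_eq_neg_integral_innerDual_of_hasCompactSupport_right h
      hu1 hζ2 hζc
    exact hG
  -- Step 2: `∫ (χ - vₙ) Δζ → 0`
  have hT1 : Tendsto (fun n ↦ ∫ x, (χ x - v n x) * F x ∂ν) atTop (𝓝 0) := by
    have h0 := (hvar ζ hζ hζc).neg
    rw [neg_zero] at h0
    exact h0.congr fun n ↦ (hgreen n).symm
  -- Step 3: `∫ (vₙ - w) Δζ → 0`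
  have hvq : ∀ n, MemLp (v n) q ν := fun n ↦
    (hv n).continuous.memLp_of_hasCompactSupport (hvc n)
  obtain ⟨hIprod, hT2⟩ := tendsto_integral_sub_mul_of_tendsto_eLpNorm (ν := ν) hq1 hvq hw hlim
    (isClosed_tsupport ζ).measurableSet hζc.isCompact.measure_lt_top (le_max_right C 0) hFC
    hFsupp hFc.aestronglyMeasurable
  -- Step 4: `∫ (χ - w) Δζ = ∫ (χ - vₙ) Δζ + ∫ (vₙ - w) Δζ` for every `n`
  have hIn : ∀ n, Integrable (fun x ↦ (χ x - v n x) * F x) ν := fun n ↦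
    (((hχ.sub (hv n)).continuous.mul hFc).integrable_of_hasCompactSupport hFcs.mul_left)
  have hsum : ∀ n, ∫ x, (χ x - w x) * F x ∂ν =
      (∫ x, (χ x - v n x) * F x ∂ν) + ∫ x, (v n x - w x) * F x ∂ν := by
    intro n
    rw [← integral_add (hIn n) (hIprod n)]
    refine integral_congr_ae (Eventually.of_forall fun x ↦ ?_)
    ring
  have hconst : Tendsto (fun n : ℕ ↦ ∫ x, (χ x - w x) * F x ∂ν) atTop (𝓝 (0 + 0)) :=
    (hT1.add hT2).congr fun n ↦ (hsum n).symm
  rw [add_zero] at hconst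
  exact tendsto_nhds_unique tendsto_const_nhds hconst

end Harmonic

end Literature.Geometry.Riemannian

end
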